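import Literature.NumberTheory.DiophantineGeometry.DenesEquationFreyCurveProofs
import Literature.NumberTheory.DiophantineGeometry.GeneralizedFermatTwoPowerCoefficientFreyProofs
import HarnessLib

/-!
# Darmon–Merel 1997, §9 "Proof of the Main Theorem for large exponents": the `j`-invariant of the
# Frey curve of Dénes' equation, Cor. 9.1, and the assembly of Main Theorem (1)

Topic `Literature/NumberTheory/DiophantineGeometry`; namespace
`Literature.NumberTheory.DiophantineGeometry`. Companion proof file (theorems only: no definition,
no named fact, no `sorry`) of the named fact
`Literature.NumberTheory.DiophantineGeometry.darmonMerel1997_denesEquation`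
(`GeneralizedFermatTwoPowerCoefficient`), continuing `DenesEquationFreyCurveProofs` (§1 of the
printed proof). Source: H. Darmon, L. Merel, *Winding quotients and some variants of Fermat's Last
Theorem*, J. reine angew. Math. 490 (1997), 81–100 (read in the authors' 26-page version).

The printed proof ends as follows (§9, Corollary 9.1 and its proof, p. 24 of the preprint):

> *Corollary 9.1. Suppose that the exponent `n` is a prime `p ≥ 7`, and let `(a, b, c)` be a
> primitive solution to equation (1) … with `abc ≠ 0`. 1. In the case of equation (1), we have
> `abc = ±1`. … Proof: Assuming that it is modular, the curve `E` constructed from a nontrivial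
> solution `(a, b, c)` to equation (1) … satisfies the assumptions of theorem 8.1. Hence `j(E)`
> belongs to `ℤ[1/p]`. It follows that `abc` … is equal to a power of `p`. But by corollary 4.4,
> the prime `p` does not divide `abc` … Corollary 9.1 follows. This completes our proof of the
> main theorem.*

Here `E : Y² = X(X − aᵖ)(X − 2cᵖ)` is the Frey curve (4) of §1, in the tree
`freyCurve (a ^ p) (-(2 * c ^ p))` (`DenesEquationFreyCurveProofs`). This file PROVES the
elementary arithmetic of this last step and of the two other places of the paper where the same
mechanism is used, and records the resulting logical shape of the whole proof as an assembly
theorem whose hypotheses are exactly the conclusions of the deep inputs: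

* `j_freyCurve`, `j_freyCurve_denes`: `j(E) = 2⁸ (A² + AB + B²)³ / (AB(A + B))²` for
  `y² = x(x − A)(x + B)`, hence `j(E) = 2⁶ (a²ᵖ − 2aᵖcᵖ + 4c²ᵖ)³ / (abc)²ᵖ` for the curve (4)
  (DM §1: `Δ = 2⁶ (abc)²ᵖ`; Serre 1987 (4.1.9) `v_ℓ(j) = −2 v_ℓ(ABC)` at odd `ℓ`).
* `not_dvd_of_j_freyCurve_denes_eq_div` — **"`j(E) ∈ ℤ[1/q]` ⟹ every prime `ℓ ≠ q` is prime
  to `abc`"** (the sentence "It follows that `abc` is equal to a power of `p`" of the proof of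
  Cor. 9.1, for an arbitrary prime `q`): the numerator `A² + AB + B²` is prime to `AB(A + B) =
  2(abc)ᵖ` (`not_dvd_sq_add_mul_add_sq`), and at `ℓ = 2` (when `c` is even) `2²ᵖ⁺² ∣ (AB(A+B))²`
  exceeds the `2⁸` of the numerator as soon as `p ≥ 4`.
* `denes_abc_eq_of_j_eq_div_of_not_dvd`, `denes_trivial_of_j_eq_div_of_not_dvd` — **Cor. 9.1 (1)
  and the last line of the paper**: if moreover `q ∤ abc` then `abc = ±1`, whence
  `(a, b, c) = ±(1, 1, 1)`.
* `denes_trivial_of_j_eq_div_two_pow` — the arithmetic end of the proof of **Prop. 4.2 (1)**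
  (p. 11: "by prop. 3.1 of [Momose], `E` has potentially good reduction at all primes `ℓ ≠ 2`. It
  follows … that `abc` … is equal to `±1`"): `j(E) ∈ ℤ[1/2]` already forces the solution to be
  trivial (`a`, `b` are odd, so they are units, and then `2cᵖ = aᵖ + bᵖ ∈ {0, ±2}`).
* `hasMultiplicativeReductionAt_freyCurve_denes_of_dvd` — the first sentence of the proof of
  **Cor. 4.4** ("Otherwise, `E` would have multiplicative reduction at `p`"): at an odd prime
  `ℓ ∣ abc` the curve (4) has multiplicative reduction (Serre 1987 (4.1.2), in the tree as
  `hasMultiplicativeReductionAt_freyCurve_of_ne_two`).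
* `darmonMerel1997_denesEquation_of_denes_of_large` — **the assembly of Main Theorem (1) for prime
  exponents `p ≥ 5` exactly as the source covers them**: from (i) the case `p = 5` (Dénes 1952,
  reference [7] of the paper, p. 3: "Dénes [7], who conjectured part 1 of our Main Theorem, and
  proved it for `2 < n < 31`") and (ii) for every prime
  `p ≥ 7` and every non-trivial primitive solution, `j(E) ∈ ℤ[1/p]` (Thm. 8.1 applied to `E` via
  Thm. 1.3, Lemma 1.2, Prop. 4.1 and Prop. 4.3) together with `p ∤ abc` (Cor. 4.4), the vendored
  statement `darmonMerel1997_denesEquation` follows (substitution `(x, y, z) ↦ (x, z, −y)` of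
  `darmonMerel1997_denesEquation_iff_primitive_trivial`).

Nothing deep is proved here: modularity (Thm. 1.3), Ribet's level-lowering (Thm. 3.1), the complex
multiplication analysis of `X₀(32)` (Props. 4.1–4.3), Tate's `p`-adic uniformisation (Cor. 4.4) and
Thm. 8.1 itself remain exactly the inputs (ii); see the census in the docstring of
`darmonMerel1997_denesEquation_iff_primitive_trivial` and the sibling files
`DenesEquationModPRepresentationProofs` (Thm. 2.2), `DenesEquationWeightTwoLevelsProofs`
(Cor. 3.2, §4, modular side).

## References

* H. Darmon, L. Merel, *Winding quotients and some variants of Fermat's Last Theorem*, J. reine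
  angew. Math. 490 (1997), 81–100: §1 (eq. (4), Prop. 1.1), §4 (Prop. 4.2, Cor. 4.4), §8
  (Thm. 8.1), §9 (Cor. 9.1). [DarmonMerel1997]
* P. Dénes, *Über die Diophantische Gleichung `xˡ + yˡ = czˡ`*, Acta Math. 88 (1952), 241–251
  (reference [7] of Darmon–Merel). [Denes1952]
* J.-P. Serre, *Sur les représentations modulaires de degré `2` de `Gal(ℚ̄/ℚ)`*, Duke Math. J. 54
  (1987), §4.1 ((4.1.2), (4.1.9)). [Serre1987]
-/

noncomputable section

open WeierstrassCurve IsDedekindDomain Rat.HeightOneSpectrum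
open Literature.NumberTheory.EllipticCurves

namespace Literature.NumberTheory.DiophantineGeometry

/-! ### The `j`-invariant of the Frey curve -/

section FreyJ

variable {A B : ℤ}

/-- **The `j`-invariant of the Frey–Hellegouarch curve** `y² = x(x − A)(x + B)` (`AB(A + B) ≠ 0`):
`j = c₄³ / Δ = 2⁸ (A² + AB + B²)³ / (AB(A + B))²`, from `c₄ = 16 (A² + AB + B²)` and
`Δ = 16 (AB(A + B))²` (Serre 1987, (4.1.9): "`v_ℓ(j_E) = −v_ℓ(Δ) = −2 v_ℓ(ABC)` si `ℓ ≠ 2`";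
Bombieri–Gubler Ex. 12.5.10). [cite: Serre1987, §4.1 (4.1.9)] -/
theorem j_freyCurve [(freyCurve A B).IsElliptic] (h0 : A * B * (A + B) ≠ 0) :
    (freyCurve A B).j =
      2 ^ 8 * ((A : ℚ) ^ 2 + A * B + B ^ 2) ^ 3 / ((A : ℚ) * B * (A + B)) ^ 2 := by
  have hD : (A : ℚ) * B * (A + B) ≠ 0 := by exact_mod_cast h0
  have hc : (freyCurve A B).c₄ = 16 * ((A : ℚ) ^ 2 + A * B + B ^ 2) := by
    simp only [WeierstrassCurve.c₄, WeierstrassCurve.b₂, WeierstrassCurve.b₄, freyCurve_a₁,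
      freyCurve_a₂, freyCurve_a₃, freyCurve_a₄]
    ring
  rw [j, Units.inv_mul_eq_iff_eq_mul, hc, coe_Δ', freyCurve_Δ, mul_div_assoc',
    eq_div_iff (pow_ne_zero 2 hD)]
  ring

end FreyJ

section DenesLarge

variable {a b c : ℤ} {p : ℕ}

/-- **The `j`-invariant of the Frey curve (4) of Darmon–Merel**, `Y² = X(X − aᵖ)(X − 2cᵖ)` for a
solution of `aᵖ + bᵖ = 2cᵖ` with `abc ≠ 0`:
`j(E) = 2⁶ (a²ᵖ − 2aᵖcᵖ + 4c²ᵖ)³ / (abc)²ᵖ` (`c₄ = 16 (a²ᵖ − 2aᵖcᵖ + 4c²ᵖ)`, and DM §1, p. 5: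
"`Δ = 2⁶ (abc)²ᵖ`"). [cite: DarmonMerel1997, §1 (arithmetic invariants of E)] -/
theorem j_freyCurve_denes [(freyCurve (a ^ p) (-(2 * c ^ p))).IsElliptic]
    (h : a ^ p + b ^ p = 2 * c ^ p) (h0 : a * b * c ≠ 0) :
    (freyCurve (a ^ p) (-(2 * c ^ p))).j =
      2 ^ 6 * ((a : ℚ) ^ (2 * p) - 2 * a ^ p * c ^ p + 4 * c ^ (2 * p)) ^ 3 /
        ((a : ℚ) * b * c) ^ (2 * p) := by
  have h0' := denes_frey_ne_zero h h0
  have hD : (((a ^ p * -(2 * c ^ p) * (a ^ p + -(2 * c ^ p)) : ℤ) : ℚ)) ^ 2 ≠ 0 := by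
    exact_mod_cast pow_ne_zero 2 h0'
  have habc : ((a : ℚ) * b * c) ^ (2 * p) ≠ 0 := by exact_mod_cast pow_ne_zero (2 * p) h0
  rw [j_freyCurve h0']
  push_cast at hD ⊢
  rw [div_eq_div_iff hD habc]
  have hb : (b : ℚ) ^ p = 2 * c ^ p - a ^ p := by
    exact_mod_cast (show b ^ p = 2 * c ^ p - a ^ p by linear_combination h)
  have key : ((a : ℚ) * b * c) ^ (2 * p) = (a ^ p) ^ 2 * (2 * c ^ p - a ^ p) ^ 2 * (c ^ p) ^ 2 := by
    rw [← hb]; ring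
  rw [key]
  ring

/-- The numerator `A² + AB + B²` (`A = aᵖ`, `B = −2cᵖ`) of `j(E)` is odd when `a` is odd.
[folklore] -/
theorem odd_denes_c₄_numerator (ha : Odd a) :
    Odd ((a ^ p) ^ 2 + a ^ p * -(2 * c ^ p) + (-(2 * c ^ p)) ^ 2) := by
  have hA : Odd (a ^ p) := ha.pow
  have hB : Even (-(2 * c ^ p) : ℤ) := (even_two_mul _).neg
  exact (hA.pow.add_even (hB.mul_left _)).add_even (hB.pow_of_ne_zero two_ne_zero)

/-- **Darmon–Merel 1997, proof of Cor. 9.1: "`j(E)` belongs to `ℤ[1/p]`. It follows that `abc` is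
equal to a power of `p`"** — for an arbitrary prime `q` in place of `p`: if the `j`-invariant of
the Frey curve `Y² = X(X − aᵖ)(X − 2cᵖ)` of a solution of `aᵖ + bᵖ = 2cᵖ` (`p ≥ 4`, `abc ≠ 0`,
`gcd(a, b) = gcd(a, c) = 1`) lies in `ℤ[1/q]`, i.e. `j(E) = m / qⁿ` with `m ∈ ℤ`, then no prime
`ℓ ≠ q` divides `abc`. Proof: `2⁸ (A² + AB + B²)³ qⁿ = m (AB(A + B))²` with `A = aᵖ`,
`B = −2cᵖ`, `AB(A + B) = 2(abc)ᵖ`; an odd `ℓ ∣ abc` divides the right-hand side but neither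
`A² + AB + B²` (`not_dvd_sq_add_mul_add_sq`) nor `2⁸ qⁿ`; and `ℓ = 2 ∣ abc` means `2 ∣ c`
(`a, b` odd), so that `2²ᵖ⁺² ∣ 2⁸ · (odd)`, impossible for `p ≥ 4`. (Equivalently, Serre 1987
(4.1.9): `v_ℓ(j) = −2p v_ℓ(abc) < 0` at odd `ℓ ∣ abc`, and `v₂(j) = 6 − 2p v₂(c) < 0` if
`2 ∣ c`.) [cite: DarmonMerel1997, Cor. 9.1 (proof)] -/
theorem not_dvd_of_j_freyCurve_denes_eq_div [(freyCurve (a ^ p) (-(2 * c ^ p))).IsElliptic]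
    (hp : 4 ≤ p) (h : a ^ p + b ^ p = 2 * c ^ p) (h0 : a * b * c ≠ 0) (hab : IsCoprime a b)
    (hac : IsCoprime a c) {q : ℕ} (hq : q.Prime) {n : ℕ} {m : ℤ}
    (hj : (freyCurve (a ^ p) (-(2 * c ^ p))).j = m / (q : ℚ) ^ n)
    {ℓ : ℕ} (hℓ : ℓ.Prime) (hℓq : ℓ ≠ q) : ¬ (ℓ : ℤ) ∣ a * b * c := by
  intro hl
  have hp1 : 1 ≤ p := by omega
  obtain ⟨ha, hb⟩ := odd_of_denes hp1 h hab
  have hAB : IsCoprime (a ^ p) (-(2 * c ^ p)) := isCoprime_denes_frey hac ha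
  have hN := odd_denes_c₄_numerator (p := p) (c := c) ha
  have h0' := denes_frey_ne_zero h h0
  have hprod := denes_frey_prod h
  -- clear denominators in `j(E) = m / q ^ n`
  have key : (2 : ℤ) ^ 8 * ((a ^ p) ^ 2 + a ^ p * -(2 * c ^ p) + (-(2 * c ^ p)) ^ 2) ^ 3 * (q : ℤ) ^ n
      = m * (a ^ p * -(2 * c ^ p) * (a ^ p + -(2 * c ^ p))) ^ 2 := by
    have hj' := hj
    rw [j_freyCurve h0'] at hj'
    have hD : (((a ^ p * -(2 * c ^ p) * (a ^ p + -(2 * c ^ p)) : ℤ) : ℚ)) ^ 2 ≠ 0 := by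
      exact_mod_cast pow_ne_zero 2 h0'
    have hqn : (q : ℚ) ^ n ≠ 0 := pow_ne_zero _ (by exact_mod_cast hq.ne_zero)
    push_cast at hD hj'
    rw [div_eq_div_iff hD hqn] at hj'
    have hj2 : (((2 : ℤ) ^ 8 * ((a ^ p) ^ 2 + a ^ p * -(2 * c ^ p) + (-(2 * c ^ p)) ^ 2) ^ 3 *
        (q : ℤ) ^ n : ℤ) : ℚ) = ((m * (a ^ p * -(2 * c ^ p) * (a ^ p + -(2 * c ^ p))) ^ 2 : ℤ) : ℚ) := by
      push_cast
      linear_combination hj'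
    exact Int.cast_injective hj2
  set A : ℤ := a ^ p with hA
  set B : ℤ := -(2 * c ^ p) with hB
  have hℓint : Prime (ℓ : ℤ) := Nat.prime_iff_prime_int.mp hℓ
  have hlD : (ℓ : ℤ) ∣ A * B * (A + B) := by
    rw [hprod]; exact dvd_mul_of_dvd_right (dvd_pow hl (by omega)) _
  have hlN : ¬ (ℓ : ℤ) ∣ A ^ 2 + A * B + B ^ 2 := not_dvd_sq_add_mul_add_sq hAB hℓ hlD
  by_cases hℓ2 : ℓ = 2
  · -- `ℓ = 2`: then `q` is odd and `c` is even
    subst hℓ2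
    have hq2 : q ≠ 2 := fun h2 ↦ hℓq h2.symm
    have hqodd : Odd (q : ℤ) := (hq.odd_of_ne_two hq2).natCast
    have hna : ¬ (2 : ℤ) ∣ a := fun h2 ↦ (Int.not_even_iff_odd.mpr ha) (even_iff_two_dvd.mpr h2)
    have hnb : ¬ (2 : ℤ) ∣ b := fun h2 ↦ (Int.not_even_iff_odd.mpr hb) (even_iff_two_dvd.mpr h2)
    have hl' : (2 : ℤ) ∣ a * b * c := by exact_mod_cast hl
    have hc2 : (2 : ℤ) ∣ c := by
      rcases Int.prime_two.dvd_or_dvd hl' with h2 | h2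
      · rcases Int.prime_two.dvd_or_dvd h2 with h2 | h2
        · exact absurd h2 hna
        · exact absurd h2 hnb
      · exact h2
    -- `2 ^ (2p + 2) ∣ (A B (A + B))² = 4 (abc)^{2p}`
    have h1 : (2 : ℤ) ^ (p * 2) ∣ (a * b * c) ^ (p * 2) :=
      pow_dvd_pow_of_dvd (hc2.trans (Dvd.intro_left _ rfl)) _
    have h2 : (2 : ℤ) ^ (p * 2 + 2) ∣ (A * B * (A + B)) ^ 2 := by
      rw [hprod, mul_pow, ← pow_mul, pow_add, mul_comm ((2 : ℤ) ^ (p * 2))]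
      exact mul_dvd_mul_left _ h1
    have h3 : (2 : ℤ) ^ (p * 2 + 2) ∣
        2 ^ 8 * ((A ^ 2 + A * B + B ^ 2) ^ 3 * (q : ℤ) ^ n) := by
      rw [← mul_assoc, key]
      exact h2.trans (Dvd.intro_left m rfl)
    have h4 : (2 : ℤ) ^ 8 * 4 ∣ 2 ^ 8 * ((A ^ 2 + A * B + B ^ 2) ^ 3 * (q : ℤ) ^ n) :=
      (pow_dvd_pow (2 : ℤ) (show 10 ≤ p * 2 + 2 by omega)).trans h3
    have h5 : (4 : ℤ) ∣ (A ^ 2 + A * B + B ^ 2) ^ 3 * (q : ℤ) ^ n :=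
      (mul_dvd_mul_iff_left (by norm_num)).mp h4
    have hodd : Odd ((A ^ 2 + A * B + B ^ 2) ^ 3 * (q : ℤ) ^ n) := hN.pow.mul hqodd.pow
    exact (Int.not_even_iff_odd.mpr hodd)
      (even_iff_two_dvd.mpr ((show (2 : ℤ) ∣ 4 by norm_num).trans h5))
  · -- `ℓ` odd, `ℓ ≠ q`
    have hdvd : (ℓ : ℤ) ∣ m * (A * B * (A + B)) ^ 2 :=
      dvd_mul_of_dvd_right (dvd_pow hlD two_ne_zero) m
    rw [← key] at hdvd
    rcases hℓint.dvd_or_dvd hdvd with h' | h'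
    · rcases hℓint.dvd_or_dvd h' with h'' | h''
      · have h2 : (ℓ : ℤ) ∣ 2 := hℓint.dvd_of_dvd_pow h''
        exact hℓ2 ((Nat.prime_dvd_prime_iff_eq hℓ Nat.prime_two).mp (by exact_mod_cast h2))
      · exact hlN (hℓint.dvd_of_dvd_pow h'')
    · have h2 : (ℓ : ℤ) ∣ q := hℓint.dvd_of_dvd_pow h'
      exact hℓq ((Nat.prime_dvd_prime_iff_eq hℓ hq).mp (by exact_mod_cast h2))

/-- **Darmon–Merel 1997, Cor. 9.1 (1)** ("In the case of equation (1), we have `abc = ±1`"), as the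
implication actually proved on p. 24: if `j(E) ∈ ℤ[1/q]` for a prime `q` with `q ∤ abc` (in the
paper `q = p`: Thm. 8.1 gives `j(E) ∈ ℤ[1/p]` and Cor. 4.4 gives `p ∤ abc`), then `abc = ±1`.
Hypotheses on the solution as in `not_dvd_of_j_freyCurve_denes_eq_div`.
[cite: DarmonMerel1997, Cor. 9.1 (1)] -/
theorem denes_abc_eq_of_j_eq_div_of_not_dvd [(freyCurve (a ^ p) (-(2 * c ^ p))).IsElliptic]
    (hp : 4 ≤ p) (h : a ^ p + b ^ p = 2 * c ^ p) (h0 : a * b * c ≠ 0) (hab : IsCoprime a b)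
    (hac : IsCoprime a c) {q : ℕ} (hq : q.Prime) {n : ℕ} {m : ℤ}
    (hj : (freyCurve (a ^ p) (-(2 * c ^ p))).j = m / (q : ℚ) ^ n) (hqabc : ¬ (q : ℤ) ∣ a * b * c) :
    a * b * c = 1 ∨ a * b * c = -1 := by
  have key : (a * b * c).natAbs = 1 := by
    refine Nat.eq_one_iff_not_exists_prime_dvd.mpr fun ℓ hℓ hℓd ↦ ?_
    have hℓd' : (ℓ : ℤ) ∣ a * b * c := Int.natCast_dvd.mpr hℓd
    by_cases hℓq : ℓ = q
    · exact hqabc (hℓq ▸ hℓd')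
    · exact not_dvd_of_j_freyCurve_denes_eq_div hp h h0 hab hac hq hj hℓ hℓq hℓd'
  simpa using Int.natAbs_eq_iff.mp key

/-- If `xyz = ±1` then each of `x, y, z` is `±1`. [folklore] -/
private theorem eq_or_eq_neg_of_mul_three {x y z : ℤ} (h : x * y * z = 1 ∨ x * y * z = -1) :
    (x = 1 ∨ x = -1) ∧ (y = 1 ∨ y = -1) ∧ (z = 1 ∨ z = -1) := by
  have hu : IsUnit (x * y * z) := by
    rcases h with h | h <;> rw [h] <;> norm_num
  rw [IsUnit.mul_iff, IsUnit.mul_iff] at hu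
  exact ⟨Int.isUnit_iff.mp hu.1.1, Int.isUnit_iff.mp hu.1.2, Int.isUnit_iff.mp hu.2⟩

/-- For odd `p`, a solution of `aᵖ + bᵖ = 2cᵖ` with `abc = ±1` is `±(1, 1, 1)` (Darmon–Merel,
Introduction: "trivial if `xyz = 0` or `±1`"; the sign analysis `a + b = 2c` on `{±1}³`).
[cite: DarmonMerel1997, Introduction p. 1] -/
theorem denes_trivial_of_abc_eq (hpo : Odd p) (h : a ^ p + b ^ p = 2 * c ^ p)
    (habc : a * b * c = 1 ∨ a * b * c = -1) :
    (a = 1 ∧ b = 1 ∧ c = 1) ∨ (a = -1 ∧ b = -1 ∧ c = -1) := by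
  obtain ⟨hx, hy, hz⟩ := eq_or_eq_neg_of_mul_three habc
  have hp1 : ∀ w : ℤ, (w = 1 ∨ w = -1) → w ^ p = w := by
    rintro w (rfl | rfl)
    · exact one_pow p
    · exact hpo.neg_one_pow
  rw [hp1 a hx, hp1 b hy, hp1 c hz] at h
  rcases hx with rfl | rfl <;> rcases hy with rfl | rfl <;> rcases hz with rfl | rfl <;>
    first
    | (left; exact ⟨rfl, rfl, rfl⟩)
    | (right; exact ⟨rfl, rfl, rfl⟩)
    | (exfalso; norm_num at h)

/-- **Darmon–Merel 1997, Cor. 9.1 (1) and the last line of the paper** ("Corollary 9.1 follows.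
This completes our proof of the main theorem"): for odd `p ≥ 4`, a solution of `aᵖ + bᵖ = 2cᵖ`
with `abc ≠ 0`, `gcd(a, b) = gcd(a, c) = 1`, whose Frey curve has `j(E) ∈ ℤ[1/q]` for a prime
`q ∤ abc`, is `±(1, 1, 1)`. [cite: DarmonMerel1997, Cor. 9.1 (1) and §9] -/
theorem denes_trivial_of_j_eq_div_of_not_dvd [(freyCurve (a ^ p) (-(2 * c ^ p))).IsElliptic]
    (hp : 4 ≤ p) (hpo : Odd p) (h : a ^ p + b ^ p = 2 * c ^ p) (h0 : a * b * c ≠ 0)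
    (hab : IsCoprime a b) (hac : IsCoprime a c) {q : ℕ} (hq : q.Prime) {n : ℕ} {m : ℤ}
    (hj : (freyCurve (a ^ p) (-(2 * c ^ p))).j = m / (q : ℚ) ^ n) (hqabc : ¬ (q : ℤ) ∣ a * b * c) :
    (a = 1 ∧ b = 1 ∧ c = 1) ∨ (a = -1 ∧ b = -1 ∧ c = -1) :=
  denes_trivial_of_abc_eq hpo h (denes_abc_eq_of_j_eq_div_of_not_dvd hp h h0 hab hac hq hj hqabc)

/-- For odd `p`, `wᵖ = 1` forces `w = 1` in `ℤ`. [folklore] -/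
private theorem eq_one_of_pow_eq_one (hpo : Odd p) {w : ℤ} (hw : w ^ p = 1) : w = 1 := by
  have h1 : w.natAbs ^ p = 1 := by rw [← Int.natAbs_pow, hw]; rfl
  have h2 : w.natAbs = 1 := by
    rcases Nat.pow_eq_one.mp h1 with h2 | h2
    · exact h2
    · exact absurd h2 hpo.pos.ne'
  rcases Int.natAbs_eq_iff.mp h2 with h3 | h3
  · simpa using h3
  · exfalso
    rw [show w = -1 by simpa using h3, hpo.neg_one_pow] at hw
    norm_num at hw

/-- **Darmon–Merel 1997, end of the proof of Prop. 4.2 (1)** (p. 11: "by prop. 3.1 of [Momose],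
`E` has potentially good reduction at all primes `ℓ ≠ 2`. It follows … that `abc` (in the case of
equation (1)) … is equal to `±1`, which implies that `(a, b, c)` is a trivial solution"), in the
form: if `j(E) ∈ ℤ[1/2]` (potentially good reduction away from `2`) then the solution is
`±(1, 1, 1)`. Indeed no odd prime divides `abc` (`not_dvd_of_j_freyCurve_denes_eq_div` with
`q = 2`), and `a, b` are odd, so `a, b = ±1` and `2cᵖ = aᵖ + bᵖ ∈ {0, ±2}`; the paper invokes
Cor. 3.2 to exclude `c` even, which this elementary count makes unnecessary at this point.
[cite: DarmonMerel1997, Prop. 4.2 (1) (proof)] -/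
theorem denes_trivial_of_j_eq_div_two_pow [(freyCurve (a ^ p) (-(2 * c ^ p))).IsElliptic]
    (hp : 4 ≤ p) (hpo : Odd p) (h : a ^ p + b ^ p = 2 * c ^ p) (h0 : a * b * c ≠ 0)
    (hab : IsCoprime a b) (hac : IsCoprime a c) {n : ℕ} {m : ℤ}
    (hj : (freyCurve (a ^ p) (-(2 * c ^ p))).j = m / (2 : ℚ) ^ n) :
    (a = 1 ∧ b = 1 ∧ c = 1) ∨ (a = -1 ∧ b = -1 ∧ c = -1) := by
  have hp1 : 1 ≤ p := by omega
  obtain ⟨ha, hb⟩ := odd_of_denes hp1 h hab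
  have hnd : ∀ {ℓ : ℕ}, ℓ.Prime → ℓ ≠ 2 → ¬ (ℓ : ℤ) ∣ a * b * c := fun hℓ hℓ2 ↦
    not_dvd_of_j_freyCurve_denes_eq_div hp h h0 hab hac Nat.prime_two (by exact_mod_cast hj) hℓ hℓ2
  -- an odd divisor of `abc` is a unit
  have hunit : ∀ {w : ℤ}, Odd w → w ∣ a * b * c → w = 1 ∨ w = -1 := by
    intro w hw hwd
    have : w.natAbs = 1 := by
      refine Nat.eq_one_iff_not_exists_prime_dvd.mpr fun ℓ hℓ hℓw ↦ ?_
      have hℓw' : (ℓ : ℤ) ∣ w := Int.natCast_dvd.mpr hℓw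
      by_cases hℓ2 : ℓ = 2
      · subst hℓ2
        exact (Int.not_even_iff_odd.mpr hw) (even_iff_two_dvd.mpr (by exact_mod_cast hℓw'))
      · exact hnd hℓ hℓ2 (hℓw'.trans hwd)
    simpa using Int.natAbs_eq_iff.mp this
  have ha1 := hunit ha ⟨b * c, by ring⟩
  have hb1 := hunit hb ⟨a * c, by ring⟩
  have hp1' : ∀ w : ℤ, (w = 1 ∨ w = -1) → w ^ p = w := by
    rintro w (rfl | rfl)
    · exact one_pow p
    · exact hpo.neg_one_pow
  rw [hp1' a ha1, hp1' b hb1] at h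
  have hc0 : c ≠ 0 := fun hc ↦ h0 (by rw [hc, mul_zero])
  have hcp0 : c ^ p ≠ 0 := pow_ne_zero p hc0
  rcases ha1 with rfl | rfl <;> rcases hb1 with rfl | rfl
  · left
    exact ⟨rfl, rfl, eq_one_of_pow_eq_one hpo (by linarith)⟩
  · exact absurd (by linarith) hcp0
  · exact absurd (by linarith) hcp0
  · right
    refine ⟨rfl, rfl, ?_⟩
    have : (-c) ^ p = 1 := by rw [hpo.neg_pow]; linarith
    linear_combination -(eq_one_of_pow_eq_one hpo this)

/-- **Darmon–Merel 1997, proof of Cor. 4.4, first sentence** ("Otherwise, `E` would have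
multiplicative reduction at `p`"), in general: at an odd prime `ℓ ∣ abc` the Frey curve
`Y² = X(X − aᵖ)(X − 2cᵖ)` of a solution of `aᵖ + bᵖ = 2cᵖ` (`p ≥ 1`, `abc ≠ 0`, `gcd(a, c) = 1`,
`a` odd) has multiplicative reduction (Serre 1987, (4.1.2); DM Prop. 1.1 (1), proof). Apply with
`ℓ = p` when `p ∣ abc`. The remaining two sentences of that proof ("`G_p` would be contained in a
Borel subgroup … by Tate's analytic theory, contradicting proposition 4.3") are not in reach of the
tree. [cite: DarmonMerel1997, Cor. 4.4 (proof)] -/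
theorem hasMultiplicativeReductionAt_freyCurve_denes_of_dvd (hp : 1 ≤ p)
    (h : a ^ p + b ^ p = 2 * c ^ p) (h0 : a * b * c ≠ 0) (hac : IsCoprime a c) (ha : Odd a)
    (v : HeightOneSpectrum ℤ) (hv : natGenerator v ≠ 2) (hl : (natGenerator v : ℤ) ∣ a * b * c) :
    (freyCurve (a ^ p) (-(2 * c ^ p))).HasMultiplicativeReductionAt v :=
  hasMultiplicativeReductionAt_freyCurve_of_ne_two (isCoprime_denes_frey hac ha)
    (denes_frey_ne_zero h h0) v hv
    (by rw [denes_frey_prod h]; exact dvd_mul_of_dvd_right (dvd_pow hl (by omega)) _)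

/-- A prime `p ≥ 5` is `5` or at least `7`. [folklore] -/
private theorem eq_five_or_seven_le {p : ℕ} (hp : p.Prime) (h5 : 5 ≤ p) : p = 5 ∨ 7 ≤ p := by
  rcases Nat.lt_or_ge p 7 with hlt | hge
  · left
    interval_cases p
    · rfl
    · exact absurd hp (by norm_num)
  · exact Or.inr hge

/-- **Darmon–Merel 1997, Main Theorem (1) for prime exponents `p ≥ 5`: the assembly of the printed
proof.** The vendored statement `darmonMerel1997_denesEquation` follows from

* (i) the case `p = 5`: every solution of `a⁵ + b⁵ = 2c⁵` in nonzero pairwise coprime integers has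
  `abc = ±1` — inside the source this is P. Dénes, Acta Math. 88 (1952), reference [7] (p. 3:
  "Equation (1) was studied in 1952 by Dénes [7], who conjectured part 1 of our Main Theorem, and
  proved it for `2 < n < 31`"), not reproved there; and
* (ii) for every prime `p ≥ 7` and every solution of `aᵖ + bᵖ = 2cᵖ` in nonzero pairwise coprime
  integers, the two conclusions which §§1–8 of the paper establish for its Frey curve
  `E : Y² = X(X − aᵖ)(X − 2cᵖ)`: `j(E) ∈ ℤ[1/p]` (Thm. 8.1, whose hypotheses are supplied by
  Lemma 1.2 — a rational subgroup of order `2` — and, via modularity Thm. 1.3, level-lowering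
  Thm. 3.1 and the complex multiplication of `X₀(32)`, Props. 4.1–4.3 — image of `ρ` equal to the
  normaliser of a non-split Cartan subgroup, the case `p ≡ 1 (mod 4)` being Prop. 4.2) and
  `p ∤ abc` (Cor. 4.4),

by Cor. 9.1 (`denes_trivial_of_j_eq_div_of_not_dvd`) and the substitution `(x, y, z) ↦ (x, z, −y)`
between `xᵖ + 2yᵖ + zᵖ = 0` and `aᵖ + bᵖ = 2cᵖ`. The hypotheses (i), (ii) are exactly the deep
inputs not available in the tree; nothing else of the paper is assumed.
[cite: DarmonMerel1997, §9 (Cor. 9.1 and "This completes our proof of the main theorem")] -/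
theorem darmonMerel1997_denesEquation_of_denes_of_large
    (hfive : ∀ a b c : ℤ, a * b * c ≠ 0 → IsCoprime a b → IsCoprime a c → IsCoprime b c →
      a ^ 5 + b ^ 5 = 2 * c ^ 5 → a * b * c = 1 ∨ a * b * c = -1)
    (hlarge : ∀ p : ℕ, p.Prime → 7 ≤ p → ∀ a b c : ℤ, a * b * c ≠ 0 → IsCoprime a b →
      IsCoprime a c → IsCoprime b c → a ^ p + b ^ p = 2 * c ^ p →
      ∀ [(freyCurve (a ^ p) (-(2 * c ^ p))).IsElliptic],
        (∃ n : ℕ, ∃ m : ℤ, (freyCurve (a ^ p) (-(2 * c ^ p))).j = m / (p : ℚ) ^ n) ∧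
          ¬ (p : ℤ) ∣ a * b * c) :
    darmonMerel1997_denesEquation := by
  intro p hp h5 x y z h0 hxy hxz hyz heq
  have hodd : Odd p := hp.odd_of_ne_two (by omega)
  -- `(a, b, c) = (x, z, -y)`
  have h0' : x * z * -y ≠ 0 := by
    intro h'; apply h0; linear_combination -h'
  have heq' : x ^ p + z ^ p = 2 * (-y) ^ p := by
    rw [hodd.neg_pow]; linear_combination heq
  have htriv : (x = 1 ∧ z = 1 ∧ -y = 1) ∨ (x = -1 ∧ z = -1 ∧ -y = -1) := by
    rcases eq_five_or_seven_le hp h5 with rfl | h7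
    · exact denes_trivial_of_abc_eq hodd heq'
        (hfive x z (-y) h0' hxz hxy.neg_right hyz.symm.neg_right heq')
    · haveI := isElliptic_freyCurve_denes heq' h0'
      obtain ⟨⟨n, m, hj⟩, hndvd⟩ :=
        hlarge p hp h7 x z (-y) h0' hxz hxy.neg_right hyz.symm.neg_right heq'
      exact denes_trivial_of_j_eq_div_of_not_dvd (by omega) hodd heq' h0' hxz hxy.neg_right hp hj
        hndvd
  rcases htriv with ⟨rfl, rfl, hy⟩ | ⟨rfl, rfl, hy⟩
  · exact Or.inl ⟨rfl, by linear_combination -hy, rfl⟩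
  · exact Or.inr ⟨rfl, by linear_combination -hy, rfl⟩

end DenesLarge

end Literature.NumberTheory.DiophantineGeometry
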